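import Summits.AtomisticToContinuum.Crystallization.Theorems.FrustratedLawDichotomyStrainedPatchHomEntryFitHcpCentredSqSound

/-!
# The slab leaf and the production verdict with the SQUARED inner pair test: soundness, containment of the verdict of record, the consumer
# (27623 `(H) HomFloor (1/625)`, hcp half; hand-1 g36; critic rows 1331 (2c) / 1337 «the 2⁻⁹ bulk cell»)

decomp-a2c hand-1 g36 (crux `AperiodicFrustratedLawGap`, stmt-AtomisticToContinuum-27623).  `…HTA2QCentredRot` / `…HTA2QExists` VERBATIM for the verdicts of
`…SqKit`: ★★ `entryLeafOKHT4A2QQDCRS_sound` (the affine-reference slab leaf with inner verdict `entryLeafOKHQDCRS`), and for the production verdict v2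
`entryLeafOKHT4A2QQDCRSE μ := decide (∃ payloads, entryLeafOKHT4A2QQDCRS …) ∨ entryLeafOKHT4A2QQDCRE μ`: `_of_certS` (a cell certified with explicit payloads and the
squared inner test), `_of_E` + ★ `treeOK_HT4A2QQDCRSE_of_E` (CONTAINMENT of the production verdict of record — every landed cell / tree stays valid), ★★ `_sound`,
★★ `hcpHalf_of_entryTreeHT4A2QQDCRSE`, ★★★ `homFloor_625_of_entryTrees6RBKP_HT4A2QQDCRSE` (the consumer), and the leaf currency `exists_tree_HT4A2QQDCRSE_of_certS`
/ `_of_cert` / `_of_HCCX` / `exists_treeOK_HT4A2QQDCRSE_of_E` for the literal ∃-tree gluing of `…EntryTreeShard.exists_tree_split_lit`.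
KERNEL (hand-1 g36 probe Q2): the FULL `2⁻⁹` bulk cell `cB065 × wB9A` passes `entryLeafOKHT4A2QQDCRS muRec qX90c pB9A2 QB9 GnB9 JB065 .leaf` with ONE inner leaf (41 s)
on top of the certificate side of record (`t = 0.018`, ≈ 460 s) ⇒ ≈ 500 s per `2⁻⁹` cell END TO END (`…HTA2QCellB9S1/2/3`).

Def-free; 0 sorry; standard axioms; no instances / notation / `#eval`.  `--supports stmt-AtomisticToContinuum-27623`.
-/

noncomputable section

namespace Summit.AtomisticToContinuum.Crystallization.Theorems.FrustratedLawDichotomyStrainedPatchHomEntryLeafHT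

open scoped BigOperators RealInnerProductSpace
open Literature.Analysis.ValidatedNumerics.Numerics
open Summit.AtomisticToContinuum.Crystallization.Theorems.ChargedEnergyGapNegative (E3)
open Summit.AtomisticToContinuum.Crystallization.Theorems.FrustratedLawDichotomySchurCut (effPot w₄₅ ω₄)
open Summit.AtomisticToContinuum.Crystallization.Theorems.FrustratedLawDichotomyAveragingRuleTightFree (TightNearCap BadNearCap)
open Summit.AtomisticToContinuum.Crystallization.Theorems.FrustratedLawDichotomyExemptAbsorption (ExemptNear)
open Summit.AtomisticToContinuum.Crystallization.Theorems.FrustratedLawDichotomyStrainedPatchHomSplit (ExRec latPt hexFrame hcpShift HomFloor)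
open Summit.AtomisticToContinuum.Crystallization.Theorems.FrustratedLawDichotomyStrainedPatchHomCurvLeafHCC (entryLeafOKHCCX entryLeafOKHCCX_sound)
open Summit.AtomisticToContinuum.Crystallization.Theorems.FrustratedLawDichotomyStrainedPatchHomPrunedPolar (homFloor_of_prunedBoxSums_selfAdjoint)
open Summit.AtomisticToContinuum.Crystallization.Theorems.FrustratedLawDichotomyStrainedPatchHomCertTree (CertTree treeOK)
open Summit.AtomisticToContinuum.Crystallization.Theorems.FrustratedLawDichotomyStrainedPatchHomEntryGram (rootC rootW)
open Summit.AtomisticToContinuum.Crystallization.Theorems.FrustratedLawDichotomyStrainedPatchHomEntryGramHcp (rootCH rootWH)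
open Summit.AtomisticToContinuum.Crystallization.Theorems.FrustratedLawDichotomyStrainedPatchHomEntryTable (muRec muRec_ok)
open Summit.AtomisticToContinuum.Crystallization.Theorems.FrustratedLawDichotomyStrainedPatchHomEntryTableP (entryLeafOK6RBKP)
open Summit.AtomisticToContinuum.Crystallization.Theorems.FrustratedLawDichotomyStrainedPatchHomEntryTreeCert (fccHalf_of_entryTree6RBKP)
open Summit.AtomisticToContinuum.Crystallization.Theorems.FrustratedLawDichotomyStrainedPatchHomEntryFlipHcp (HcpDich hcpHalf_of_entryTreeShuf)
open Summit.AtomisticToContinuum.Crystallization.Theorems.FrustratedLawDichotomyStrainedPatchHomEntryFitHcpCentred (entryLeafOKHQDCRS entryLeafOKHQDCRS_sound)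

/-! ## §1. The slab leaf with the squared inner test -/

/-- ★★ Soundness of `entryLeafOKHT4A2QQDCRS` in the hver shape. [folklore chaining: `entryLeafOKHT4A2Q_sound` with `entryLeafOKHQDCRS_sound`] -/
theorem entryLeafOKHT4A2QQDCRS_sound {μ : ℤ} {q : Fin 4 → ℤ} {p : HTCert} {Q : Fin 3 → ℤ} {Gn : ℤ} {J : Fin 3 → Fin 3 × Fin 3 → ℤ}
    {t : CertTree ((Fin 3 × Fin 3) ⊕ Fin 3)} {c w : (Fin 3 × Fin 3) ⊕ Fin 3 → ℤ} (h : entryLeafOKHT4A2QQDCRS μ q p Q Gn J t c w = true) (U : E3 →L[ℝ] E3) (ξ : E3)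
    (hsa : ∀ v v' : E3, ⟪U v, v'⟫ = ⟪v, U v'⟫) (hU : ‖U - 1‖ ≤ 1 / 4)
    (hbox : ∀ ab : Fin 3 × Fin 3, |(U (EuclideanSpace.single ab.2 (1 : ℝ))) ab.1 - (c (Sum.inl ab) : ℝ) / SC| ≤ (w (Sum.inl ab) : ℝ) / SC)
    (hξ : ∀ i : Fin 3, |ξ i - (c (Sum.inr i) : ℝ) / SC| ≤ (w (Sum.inr i) : ℝ) / SC) (h0 : 0 ≤ ξ 0) (h2 : 0 ≤ ξ 2) :
    (∀ (M : ℕ) (z : Fin M → E3) (cc : Fin M), Function.Injective z →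
        Set.range z = {x : E3 | dist x (z cc) ≤ 133 / 10 ∧ ∃ a : Fin 3 → ℤ,
          x = z cc + latPt U hexFrame a ∨ x = z cc + latPt U hexFrame a + U (hcpShift + ξ)} →
        TightNearCap (9 / 5) (3 / 2) z cc ∨ ExemptNear (9 / 5) ExRec z cc ∨ BadNearCap (9 / 5) (3 / 2) z cc) ∨
      (μ : ℝ) / SC ≤ ∑ b ∈ (Fintype.piFinset fun _ : Fin 3 => Finset.Icc (-7 : ℤ) 7).filter (fun b => b ≠ 0), effPot w₄₅ ω₄ (3 / 400) ‖latPt U hexFrame b‖ +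
        ∑ b ∈ (Fintype.piFinset fun _ : Fin 3 => Finset.Icc (-7 : ℤ) 7), effPot w₄₅ ω₄ (3 / 400) ‖latPt U hexFrame b + U (hcpShift + ξ)‖ :=
  entryLeafOKHT4A2Q_sound (fun c' w' hv V η hVsa hV1 hVb hη h0' h2' => entryLeafOKHQDCRS_sound c' w' hv V η hVsa hV1 hVb hη h0' h2') h U ξ hsa hU hbox hξ h0 h2

/-! ## §2. The production verdict v2: leaf lemmas, containment, soundness, consumer -/

/-- ★ A cell certified with EXPLICIT payloads and the squared inner test passes the production verdict v2. [formal bookkeeping] -/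
theorem entryLeafOKHT4A2QQDCRSE_of_certS {μ : ℤ} {q : Fin 4 → ℤ} {p : HTCert} {Q : Fin 3 → ℤ} {Gn : ℤ} {J : Fin 3 → Fin 3 × Fin 3 → ℤ}
    {t : CertTree ((Fin 3 × Fin 3) ⊕ Fin 3)} {c w : (Fin 3 × Fin 3) ⊕ Fin 3 → ℤ} (h : entryLeafOKHT4A2QQDCRS μ q p Q Gn J t c w = true) :
    entryLeafOKHT4A2QQDCRSE μ c w = true := by
  unfold entryLeafOKHT4A2QQDCRSE
  rw [Bool.or_eq_true]
  exact Or.inl (@decide_eq_true _ (Classical.propDecidable _) ⟨q, p, Q, Gn, J, t, h⟩)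

/-- CONTAINMENT at the leaf: the production verdict of record `entryLeafOKHT4A2QQDCRE μ` implies v2. [formal bookkeeping] -/
theorem entryLeafOKHT4A2QQDCRSE_of_E {μ : ℤ} {c w : (Fin 3 × Fin 3) ⊕ Fin 3 → ℤ} (h : entryLeafOKHT4A2QQDCRE μ c w = true) :
    entryLeafOKHT4A2QQDCRSE μ c w = true := by
  unfold entryLeafOKHT4A2QQDCRSE
  rw [Bool.or_eq_true]
  exact Or.inr h

/-- A cell certified with explicit payloads for the slab leaf OF RECORD passes v2. [formal bookkeeping] -/
theorem entryLeafOKHT4A2QQDCRSE_of_cert {μ : ℤ} {q : Fin 4 → ℤ} {p : HTCert} {Q : Fin 3 → ℤ} {Gn : ℤ} {J : Fin 3 → Fin 3 × Fin 3 → ℤ}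
    {t : CertTree ((Fin 3 × Fin 3) ⊕ Fin 3)} {c w : (Fin 3 × Fin 3) ⊕ Fin 3 → ℤ} (h : entryLeafOKHT4A2QQDCR μ q p Q Gn J t c w = true) :
    entryLeafOKHT4A2QQDCRSE μ c w = true :=
  entryLeafOKHT4A2QQDCRSE_of_E (entryLeafOKHT4A2QQDCRE_of_cert h)

/-- A cell passing the union verdict of record passes v2. [formal bookkeeping] -/
theorem entryLeafOKHT4A2QQDCRSE_of_HCCX {μ : ℤ} {c w : (Fin 3 × Fin 3) ⊕ Fin 3 → ℤ} (h : entryLeafOKHCCX μ c w = true) :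
    entryLeafOKHT4A2QQDCRSE μ c w = true :=
  entryLeafOKHT4A2QQDCRSE_of_E (entryLeafOKHT4A2QQDCRE_of_HCCX h)

/-- ★ CONTAINMENT for whole certificate trees: a tree accepted by the production verdict of record is accepted by v2. [formal bookkeeping] -/
theorem treeOK_HT4A2QQDCRSE_of_E {μ : ℤ} {t : CertTree ((Fin 3 × Fin 3) ⊕ Fin 3)} {c w : (Fin 3 × Fin 3) ⊕ Fin 3 → ℤ}
    (h : treeOK (entryLeafOKHT4A2QQDCRE μ) t c w = true) : treeOK (entryLeafOKHT4A2QQDCRSE μ) t c w = true :=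
  treeOK_mono (fun _ _ h' => entryLeafOKHT4A2QQDCRSE_of_E h') t c w h

/-- ★★ Soundness of `entryLeafOKHT4A2QQDCRSE` in the hver shape. [folklore chaining: a classical witness of the existential feeds
`entryLeafOKHT4A2QQDCRS_sound`; the other disjunct is `entryLeafOKHT4A2QQDCRE_sound`] -/
theorem entryLeafOKHT4A2QQDCRSE_sound {μ : ℤ} {c w : (Fin 3 × Fin 3) ⊕ Fin 3 → ℤ} (h : entryLeafOKHT4A2QQDCRSE μ c w = true) (U : E3 →L[ℝ] E3) (ξ : E3)
    (hsa : ∀ v v' : E3, ⟪U v, v'⟫ = ⟪v, U v'⟫) (hU : ‖U - 1‖ ≤ 1 / 4)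
    (hbox : ∀ ab : Fin 3 × Fin 3, |(U (EuclideanSpace.single ab.2 (1 : ℝ))) ab.1 - (c (Sum.inl ab) : ℝ) / SC| ≤ (w (Sum.inl ab) : ℝ) / SC)
    (hξ : ∀ i : Fin 3, |ξ i - (c (Sum.inr i) : ℝ) / SC| ≤ (w (Sum.inr i) : ℝ) / SC) (h0 : 0 ≤ ξ 0) (h2 : 0 ≤ ξ 2) :
    (∀ (M : ℕ) (z : Fin M → E3) (cc : Fin M), Function.Injective z →
        Set.range z = {x : E3 | dist x (z cc) ≤ 133 / 10 ∧ ∃ a : Fin 3 → ℤ,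
          x = z cc + latPt U hexFrame a ∨ x = z cc + latPt U hexFrame a + U (hcpShift + ξ)} →
        TightNearCap (9 / 5) (3 / 2) z cc ∨ ExemptNear (9 / 5) ExRec z cc ∨ BadNearCap (9 / 5) (3 / 2) z cc) ∨
      (μ : ℝ) / SC ≤ ∑ b ∈ (Fintype.piFinset fun _ : Fin 3 => Finset.Icc (-7 : ℤ) 7).filter (fun b => b ≠ 0), effPot w₄₅ ω₄ (3 / 400) ‖latPt U hexFrame b‖ +
        ∑ b ∈ (Fintype.piFinset fun _ : Fin 3 => Finset.Icc (-7 : ℤ) 7), effPot w₄₅ ω₄ (3 / 400) ‖latPt U hexFrame b + U (hcpShift + ξ)‖ := by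
  unfold entryLeafOKHT4A2QQDCRSE at h
  rw [Bool.or_eq_true] at h
  rcases h with h | h
  · obtain ⟨q, p, Q, Gn, J, t, ht⟩ := @of_decide_eq_true _ (Classical.propDecidable _) h
    exact entryLeafOKHT4A2QQDCRS_sound ht U ξ hsa hU hbox hξ h0 h2
  · exact entryLeafOKHT4A2QQDCRE_sound h U ξ hsa hU hbox hξ h0 h2

/-- ★★ The hcp half from ONE certificate tree over `entryLeafOKHT4A2QQDCRSE μ`. [folklore chaining] -/
theorem hcpHalf_of_entryTreeHT4A2QQDCRSE {m : ℝ} {μ : ℤ} (hμ : 2 * (m + (-(7175 / 10000) + 3 / 400)) * SC ≤ μ)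
    {t : CertTree ((Fin 3 × Fin 3) ⊕ Fin 3)} (h : treeOK (entryLeafOKHT4A2QQDCRSE μ) t rootCH rootWH = true) :
    ∀ (U : E3 →L[ℝ] E3) (ξ : E3), (∀ v w : E3, inner ℝ (U v) w = inner ℝ v (U w)) → (∀ w : E3, 0 ≤ inner ℝ w (U w)) →
      ‖U - 1‖ ≤ 1 / 4 → ‖ξ‖ ≤ 1 / 4 → HcpDich m U ξ :=
  hcpHalf_of_entryTreeShuf hμ (entryLeafOKHT4A2QQDCRSE μ) (fun _ _ hv U ξ hsa hU hbox hξ h0 h2 => entryLeafOKHT4A2QQDCRSE_sound hv U ξ hsa hU hbox hξ h0 h2) h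

/-- ★★★ **`(H) HomFloor (1/625)` FROM THE fcc ∃-TREE AND ONE hcp ∃-TREE OVER THE PRODUCTION VERDICT v2** (`μ = muRec`): every leaf is an explicit-payload
slab-leaf kernel fact of its cell (squared OR linearised inner test) or the union verdict of record, glued by the literal ∃-tree currency. [folklore] -/
theorem homFloor_625_of_entryTrees6RBKP_HT4A2QQDCRSE
    (hF : ∃ t : CertTree (Fin 3 × Fin 3), treeOK (entryLeafOK6RBKP muRec) t rootC rootW = true)
    (hH : ∃ t : CertTree ((Fin 3 × Fin 3) ⊕ Fin 3), treeOK (entryLeafOKHT4A2QQDCRSE muRec) t rootCH rootWH = true) : HomFloor (1 / 625) := by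
  obtain ⟨tF, htF⟩ := hF
  obtain ⟨tH, htH⟩ := hH
  exact homFloor_of_prunedBoxSums_selfAdjoint (fccHalf_of_entryTree6RBKP muRec_ok htF) (hcpHalf_of_entryTreeHT4A2QQDCRSE muRec_ok htH)

/-- ★★★ CONTAINMENT at the consumer: the `hH` hypothesis of the consumer of record `…HTA2QExists.homFloor_625_of_entryTrees6RBKP_HT4A2QQDCRE` yields the `hH`
hypothesis of the v2 consumer. [formal bookkeeping] -/
theorem exists_treeOK_HT4A2QQDCRSE_of_E {μ : ℤ} {c w : (Fin 3 × Fin 3) ⊕ Fin 3 → ℤ}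
    (hH : ∃ t : CertTree ((Fin 3 × Fin 3) ⊕ Fin 3), treeOK (entryLeafOKHT4A2QQDCRE μ) t c w = true) :
    ∃ t : CertTree ((Fin 3 × Fin 3) ⊕ Fin 3), treeOK (entryLeafOKHT4A2QQDCRSE μ) t c w = true := by
  obtain ⟨t, ht⟩ := hH
  exact ⟨t, treeOK_HT4A2QQDCRSE_of_E ht⟩

/-- ★ LEAF CURRENCY: a cell certified with explicit payloads and the squared inner test IS a one-leaf ∃-tree over v2. [formal bookkeeping] -/
theorem exists_tree_HT4A2QQDCRSE_of_certS {μ : ℤ} {q : Fin 4 → ℤ} {p : HTCert} {Q : Fin 3 → ℤ} {Gn : ℤ} {J : Fin 3 → Fin 3 × Fin 3 → ℤ}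
    {t : CertTree ((Fin 3 × Fin 3) ⊕ Fin 3)} {c w : (Fin 3 × Fin 3) ⊕ Fin 3 → ℤ} (h : entryLeafOKHT4A2QQDCRS μ q p Q Gn J t c w = true) :
    ∃ t' : CertTree ((Fin 3 × Fin 3) ⊕ Fin 3), treeOK (entryLeafOKHT4A2QQDCRSE μ) t' c w = true :=
  ⟨.leaf, entryLeafOKHT4A2QQDCRSE_of_certS h⟩

/-- LEAF CURRENCY for a cell certified under the slab leaf of record. [formal bookkeeping] -/
theorem exists_tree_HT4A2QQDCRSE_of_cert {μ : ℤ} {q : Fin 4 → ℤ} {p : HTCert} {Q : Fin 3 → ℤ} {Gn : ℤ} {J : Fin 3 → Fin 3 × Fin 3 → ℤ}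
    {t : CertTree ((Fin 3 × Fin 3) ⊕ Fin 3)} {c w : (Fin 3 × Fin 3) ⊕ Fin 3 → ℤ} (h : entryLeafOKHT4A2QQDCR μ q p Q Gn J t c w = true) :
    ∃ t' : CertTree ((Fin 3 × Fin 3) ⊕ Fin 3), treeOK (entryLeafOKHT4A2QQDCRSE μ) t' c w = true :=
  ⟨.leaf, entryLeafOKHT4A2QQDCRSE_of_cert h⟩

/-- LEAF CURRENCY for the union verdict of record. [formal bookkeeping] -/
theorem exists_tree_HT4A2QQDCRSE_of_HCCX {μ : ℤ} {c w : (Fin 3 × Fin 3) ⊕ Fin 3 → ℤ} (h : entryLeafOKHCCX μ c w = true) :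
    ∃ t' : CertTree ((Fin 3 × Fin 3) ⊕ Fin 3), treeOK (entryLeafOKHT4A2QQDCRSE μ) t' c w = true :=
  ⟨.leaf, entryLeafOKHT4A2QQDCRSE_of_HCCX h⟩

end Summit.AtomisticToContinuum.Crystallization.Theorems.FrustratedLawDichotomyStrainedPatchHomEntryLeafHT
end

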